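import Mathlib

/-!
# The Young-shadow SECTOR SPLIT of `LaplaceOptimalFive` — definitions
# (crux `RankRigidMinimalRepr`, stmt-ValiantsHypothesis-18034; frontier rung `LaplaceOptimalFive`, stmt-24813; crux idea #6
#  `young-shadow` of val-idea-19 g6, `Cruxes/LaplaceOptimalFive/YoungShadowSketch.lean` @03c74d92d6ab, ported to `Theorems/`
#  per director-valiant g16 R282 (2)(d))

A split term `u ⊗_S w` of a decomposition of the `5 × 5` permutation pattern `P₅ = [v injective]` has a short factor read on the
slots of `S` and a long factor read on the slots of `Sᶜ`.  Decomposing each factor under the permutations of the SLOTS of its own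
side splits every decomposition into a SIDE-SYMMETRIC sector (both factors of every term slot-symmetric on their side) and the
rest.  This file fixes the vocabulary (verbatim bodies of the sketch, same names):

* `SlotInvariantOn A T` — the tensor `T : (Fin 5 → Fin 5) → ℂ` is invariant under every slot permutation fixing `Aᶜ` pointwise;
* `SideSymmetric T S u w`, `IsSplitDecomposition T S u w` (the three hypotheses of `LaplaceOptimal 5`), `laplaceWeight T S`;
* the two sectors `SideSymLaplaceOptimalFive` (K1) and `AsymLaplaceOptimalFive` (K2), whose conjunction is the crux
  (`…LaplaceFiveSectorSplit.laplaceOptimalFive_of_sectors`, both converses proved there — sectors, not strengthenings);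
* `InvUnder τ T` (invariance under one slot permutation) and the availability tests `AvP` / `av` used by the two-split separation
  lemma (`…LaplaceFiveSectorSplit.twoSplit_separation`).

HONEST FRAMING: definitions only; `LaplaceOptimalFive` (stmt-24813) is OPEN · CONTESTED 72/120; `RankRigidMinimalRepr` does not
move; nothing here bears on `VP ≠ VNP`, which is NOT proved.
-/

set_option autoImplicit false

-- the mandated summit-side namespace repeats a component by design (single-problem summit)
set_option linter.dupNamespace false

namespace Summit.ValiantsHypothesis.ValiantsHypothesis.Theorems.RigidityForcesSymmetryRankRigidMinimalRepr

namespace LaplaceFiveSectorSplit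

open Finset

/-- `T : (Fin 5 → Fin 5) → ℂ` (a tensor in `V^{⊗5}`, `V = ℂ⁵`, read as a function of words) is invariant under every permutation
of the SLOTS that fixes the slots outside `A` pointwise; the action is `(τ • T) v = T (v ∘ τ)`. -/
def SlotInvariantOn (A : Finset (Fin 5)) (T : (Fin 5 → Fin 5) → ℂ) : Prop :=
  ∀ τ : Equiv.Perm (Fin 5), (∀ i, i ∉ A → τ i = i) → ∀ v : Fin 5 → Fin 5, T (v ∘ ⇑τ) = T v

/-- A family of split terms `(S t, u t, w t)_{t ∈ T}` is SIDE-SYMMETRIC when every short factor is symmetric in the slots of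
`S t` and every long factor is symmetric in the slots of `(S t)ᶜ` (e.g. an honest Laplace term `perm-minor ⊗ complementary
perm-minor`, or any term whose factors are polarisations of homogeneous polynomials). -/
def SideSymmetric {N : ℕ} (T : Finset (Fin N)) (S : Fin N → Finset (Fin 5)) (u w : Fin N → (Fin 5 → Fin 5) → ℂ) : Prop :=
  ∀ t ∈ T, SlotInvariantOn (S t) (u t) ∧ SlotInvariantOn (S t)ᶜ (w t)

/-- The three hypotheses of `LaplaceOptimal 5`: short factors read only the slots in `S t`, long factors only the slots
outside `S t`, and the terms sum to the pattern `P₅ = [v injective]`. -/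
def IsSplitDecomposition {N : ℕ} (T : Finset (Fin N)) (S : Fin N → Finset (Fin 5)) (u w : Fin N → (Fin 5 → Fin 5) → ℂ) :
    Prop :=
  (∀ t, ∀ v v' : Fin 5 → Fin 5, (∀ i ∈ S t, v i = v' i) → u t v = u t v') ∧
  (∀ t, ∀ v v' : Fin 5 → Fin 5, (∀ i, i ∉ S t → v i = v' i) → w t v = w t v') ∧
  (∀ v : Fin 5 → Fin 5, (∑ t ∈ T, u t v * w t v) = if Function.Injective v then 1 else 0)

/-- The Laplace weight `Σ_t |S_t|! (5 − |S_t|)!` (pair / triple splits cost 12, slices 24). -/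
def laplaceWeight {N : ℕ} (T : Finset (Fin N)) (S : Fin N → Finset (Fin 5)) : ℕ :=
  ∑ t ∈ T, (S t).card.factorial * (5 - (S t).card).factorial

/-- K1 — THE SYMMETRIC SECTOR `SymLO5`: every SIDE-SYMMETRIC split decomposition of `P₅` has weight `≥ 120`.  A consequence of
the crux (`sideSym_of_laplaceOptimal_five`).  CALIBRATION (idea card): the honest weight-648 decomposition of `P₆`
(`LaplaceSixExact.not_laplaceOptimal_six`) IS side-symmetric, so the `d = 6` analogue of K1 is FALSE; the certified `d = 5` border
family lives in the ASYMMETRIC sector. -/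
def SideSymLaplaceOptimalFive : Prop :=
  ∀ (N : ℕ) (T : Finset (Fin N)) (S : Fin N → Finset (Fin 5)) (u w : Fin N → (Fin 5 → Fin 5) → ℂ),
    IsSplitDecomposition T S u w → SideSymmetric T S u w → Nat.factorial 5 ≤ laplaceWeight T S

/-- K2 — THE ASYMMETRIC SLICE (honest remainder of the crux): every split decomposition of `P₅` that is NOT side-symmetric has
weight `≥ 120`.  No mechanism is claimed beyond the normal form «the shadows solve a flux-perturbed symmetric problem».
LABEL OF RECORD (crit-3 g4 young-shadow verdict P3, director R280): K2 is the crux IN COSTUME on the weight range `[72, 96)` — a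
cancelling pair `t₊/t₋` on the split `{0,1}` with a NON-symmetric short factor (e.g. `[v 0 = 0] ⊗ 1` and `[v 0 = 0] ⊗ (−1)`; the
padding mechanism of `…Negative.DepthOnePadding`, p648754) makes any exact system non-side-symmetric at cost `+24` without changing
exactness — so a line wiring `laplaceOptimal_five_iff_sectors` keeps K2 as a LABELLED RESIDUAL (0 provers) and puts instruments
only on K1 `SideSymLaplaceOptimalFive` and its sub-pieces. -/
def AsymLaplaceOptimalFive : Prop :=
  ∀ (N : ℕ) (T : Finset (Fin N)) (S : Fin N → Finset (Fin 5)) (u w : Fin N → (Fin 5 → Fin 5) → ℂ),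
    IsSplitDecomposition T S u w → ¬ SideSymmetric T S u w → Nat.factorial 5 ≤ laplaceWeight T S

/-- Invariance of a tensor under ONE slot permutation. -/
def InvUnder (τ : Equiv.Perm (Fin 5)) (T : (Fin 5 → Fin 5) → ℂ) : Prop := ∀ v : Fin 5 → Fin 5, T (v ∘ ⇑τ) = T v

/-- The transpositions DIRECTLY available from the two Young subgroups of the pair splits `{p,q}` and `{r,s}` (both letters on
the same side of one of the two splits), as a Prop … -/
def AvP (p q r s x y : Fin 5) : Prop :=
  ((x = p ∨ x = q) ∧ (y = p ∨ y = q)) ∨ (¬(x = p ∨ x = q) ∧ ¬(y = p ∨ y = q)) ∨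
  ((x = r ∨ x = s) ∧ (y = r ∨ y = s)) ∨ (¬(x = r ∨ x = s) ∧ ¬(y = r ∨ y = s))

/-- … and as a Boolean test (for `decide`). -/
def av (p q r s x y : Fin 5) : Bool :=
  decide (((x = p ∨ x = q) ∧ (y = p ∨ y = q)) ∨ (¬(x = p ∨ x = q) ∧ ¬(y = p ∨ y = q)) ∨
    ((x = r ∨ x = s) ∧ (y = r ∨ y = s)) ∨ (¬(x = r ∨ x = s) ∧ ¬(y = r ∨ y = s)))

end LaplaceFiveSectorSplit

end Summit.ValiantsHypothesis.ValiantsHypothesis.Theorems.RigidityForcesSymmetryRankRigidMinimalRepr
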